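import Literature.AlgebraicGeometry.Frobenioids.FinSubextCatSlim
import Literature.AlgebraicGeometry.Frobenioids.PreFrobenioidData
import HarnessLib

/-!
# Frobenioids I, §6: Div-slimness of `D = B(G)⁰` relative to a divisor monoid — the criterion of
# Theorem 6.2 (iv) (and the Div-slim clause of Theorem 6.4 (i)) — PROOFS modulo pull-back injectivity

Mochizuki, *The geometry of Frobenioids I*, kurims p. 111 (Thm. 6.2 (iv): "`D` is Div-slim [relative to
`Φ`] if and only if, for every `1 ≠ z ∈ Z`, there exists a finite Galois extension `L ⊆ K̃` of `K` such
that `z` acts nontrivially on `Φ(L)`"), proof p. 112. [cite: MochizukiFrdI2008, Thm. 6.2 (iv) p.111]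

Setting: `D = FinSubextCat F K` for a Galois extension `K/F`, and ANY divisor-monoid data on `D` — here
the `(Mon, pull)` part of a `PreFrobenioidData S` over `D` (abc-iut-L1-t3's operations interface). The
printed argument transports a nontrivial action along the inclusions `Spec L'' → Spec L'`; this uses that
pull-back of divisors along a morphism of `D` is injective — true for Cartier divisors under the finite
dominant maps `V[L''] → V[L']` of Ex. 6.1 and for arithmetic divisors (Ex. 6.3: multiplication by
ramification indices), but NOT a consequence of the typed interfaces `GeometricModelFrobenioid` /
`ArithModelFrobenioid`, whose `monEquiv` carries no naturality. It is therefore an explicit hypothesis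
`PullInjective S` here (FINDING F3 to abc-iut-L1-t3 / L1-lead, INBOX 2026-08-25). PROVED (with the
Div-slim condition of Def. 4.5 (iv) written out, so that this file does not wait for its home module):
`aut_eq_one_of_movesGalois` (⇐) and `movesGalois_of_aut_eq_one` (⇒).
-/

noncomputable section

namespace Literature.AlgebraicGeometry.Frobenioids

open CategoryTheory IntermediateField

universe w u v u₁

namespace FinSubextCat

variable {F : Type u₁} [Field F] {K : Type u₁} [Field K] [Algebra F K]
variable {C : Type u} [Category.{v} C] (S : PreFrobenioidData.{w} C (FinSubextCat F K))

/-- Pull-back of divisors along every morphism of `D` is injective (holds in the models of Ex. 6.1 /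
Ex. 6.3; not part of the typed interfaces — see the file header). [cite: MochizukiFrdI2008, Thm. 6.2 (iv) p.112] -/
def PullInjective : Prop := ∀ ⦃X Y : FinSubextCat F K⦄ (m : Y ⟶ X), Function.Injective (S.pull m)

/-- "for every `1 ≠ z ∈ Z`, there exists a finite Galois extension `L ⊆ K̃` of `K` such that `z` acts
nontrivially on `Φ(L)`" (FrdI Thm. 6.2 (iv) p. 111), in the form typed by abc-iut-L1-t3 (`Thm62iv`,
third conjunct, right-hand side). [cite: MochizukiFrdI2008, Thm. 6.2 (iv) p.111] -/
def MovesSomeGalois : Prop :=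
  ∀ z ∈ commOpenSubgroup F K, z ≠ 1 →
    ∃ (X : FinSubextCat F K) (_ : IsGalois F X.L) (σ : X ⟶ X),
      (∀ a : X.L, ((σ.toAlgHom a : X.L) : K) = z ((a : X.L) : K)) ∧ ∃ x : S.Mon X, S.pull σ x ≠ x

variable {S}

/-- Transport of a trivial action along a commuting square `m ≫ σ = σ'' ≫ m` with `pull m` injective:
if `σ''` acts trivially then so does `σ`. [cite: MochizukiFrdI2008, Thm. 6.2 (iv) p.112] -/
theorem pull_eq_self_of_square (hinj : PullInjective S) {X Y : FinSubextCat F K} (m : Y ⟶ X)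
    (σ : X ⟶ X) (σ'' : Y ⟶ Y) (hsq : m ≫ σ = σ'' ≫ m)
    (htriv : ∀ y : S.Mon Y, S.pull σ'' y = y) (x : S.Mon X) : S.pull σ x = x := by
  apply hinj m
  rw [← S.pull_comp, hsq, S.pull_comp, htriv]

/-- An element of `G` maps a normal intermediate field into itself. [cite: MochizukiFrdI2008, Thm. 6.2 (iv) p.112] -/
theorem apply_mem_of_normal (E : IntermediateField F K) [Normal F E] (g : K ≃ₐ[F] K) {x : K}
    (hx : x ∈ E) : g x ∈ E := by
  have h := AlgHom.fieldRange_of_normal ((g : K →ₐ[F] K).comp E.val)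
  have hmem : g x ∈ ((g : K →ₐ[F] K).comp E.val).fieldRange :=
    AlgHom.mem_fieldRange.mpr ⟨⟨x, hx⟩, rfl⟩
  rwa [h] at hmem

/-- The automorphism `g|_E` of `Spec E` in `D` for a normal `E`. [cite: MochizukiFrdI2008, Thm. 6.2 (iv) p.112] -/
def autMor (E : IntermediateField F K) [FiniteDimensional F E] [Normal F E] (g : K ≃ₐ[F] K) :
    (⟨E⟩ : FinSubextCat F K) ⟶ ⟨E⟩ :=
  ⟨restrictAlgHom (g : K →ₐ[F] K) E E fun _ hx => apply_mem_of_normal E g hx⟩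

/-- `g|_E` has the values of `g`. [cite: MochizukiFrdI2008, Thm. 6.2 (iv) p.112] -/
@[simp] theorem autMor_toAlgHom_apply_coe (E : IntermediateField F K) [FiniteDimensional F E]
    [Normal F E] (g : K ≃ₐ[F] K) (a : E) : ((autMor E g).toAlgHom a : K) = g a := rfl

/-- `(g h)|_E = g|_E ∘ h|_E` (as morphisms of `D`: `Spec` reverses composition). [cite: MochizukiFrdI2008, Thm. 6.2 (iv) p.112] -/
theorem autMor_mul (E : IntermediateField F K) [FiniteDimensional F E] [Normal F E]
    (g h : K ≃ₐ[F] K) : autMor E (g * h) = autMor E g ≫ autMor E h :=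
  hom_ext (AlgHom.ext fun _ => Subtype.ext rfl)

/-- `1|_E = id`. [cite: MochizukiFrdI2008, Thm. 6.2 (iv) p.112] -/
theorem autMor_one (E : IntermediateField F K) [FiniteDimensional F E] [Normal F E] :
    autMor E (1 : K ≃ₐ[F] K) = 𝟙 _ :=
  hom_ext (AlgHom.ext fun _ => Subtype.ext rfl)

variable [IsGalois F K]

/-- **Theorem 6.2 (iv)**, Div-slim criterion, direction ⇐ (PROVED modulo `PullInjective`): if every
`1 ≠ z ∈ Z` acts nontrivially on `Φ(L)` for some finite Galois `L`, then `D` is Div-slim.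
[cite: MochizukiFrdI2008, Thm. 6.2 (iv) p.111] -/
theorem aut_eq_one_of_movesGalois (hinj : PullInjective S) (hmv : MovesSomeGalois S)
    (A : FinSubextCat F K) (α : Aut (Over.forget A))
    (hα : ∀ (B : Over A) (x : S.Mon B.left), S.pull (α.hom.app B) x = x) : α = 1 := by
  -- the element of `Z` attached to `α`
  by_cases hz1 : centralizerOfAutForget A α = 1
  · exact eq_refl_of_centralizerOfAutForget_eq_one A α hz1
  exfalso
  obtain ⟨X, hXgal, σ, hσ, x, hx⟩ := hmv _ (centralizerOfAutForget_mem A α) hz1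
  -- the object `Spec (X.L ⊔ A.L) → Spec A.L` of `D_A`, and the inclusion `Spec (X.L ⊔ A.L) → Spec X.L`
  let L'' : IntermediateField F K := X.L ⊔ A.L
  have hA : A.L ≤ L'' := le_sup_right
  have hX : X.L ≤ L'' := le_sup_left
  let m : (⟨L''⟩ : FinSubextCat F K) ⟶ X := ⟨IntermediateField.inclusion hX⟩
  have hsq : m ≫ σ = (α.hom.app (overIncl A L'' hA)) ≫ m := by
    refine hom_ext (AlgHom.ext fun a => Subtype.ext ?_)
    show ((σ.toAlgHom a : X.L) : K) = (inclApp A α L'' hA (IntermediateField.inclusion hX a) : K)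
    rw [hσ, ← centralizerOfAutForget_apply A α hA]
    rfl
  exact hx (pull_eq_self_of_square hinj m σ _ hsq (hα (overIncl A L'' hA)) x)

/-- **Theorem 6.2 (iv)**, Div-slim criterion, direction ⇒ (PROVED modulo `PullInjective`): if `D` is
Div-slim, then every `1 ≠ z ∈ Z` acts nontrivially on `Φ(L)` for some finite Galois `L ⊆ K` over `F`
(namely a normal closure of the field of an object on which the automorphism of `D_A → D` attached to `z`
acts nontrivially). [cite: MochizukiFrdI2008, Thm. 6.2 (iv) p.111] -/
theorem movesGalois_of_aut_eq_one (hinj : PullInjective S)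
    (hS : ∀ (A : FinSubextCat F K) (α : Aut (Over.forget A)),
      (∀ (B : Over A) (x : S.Mon B.left), S.pull (α.hom.app B) x = x) → α = 1) :
    MovesSomeGalois S := by
  rintro z ⟨H, hHo, hz⟩ hne
  obtain ⟨E, hEfin, hEH⟩ :=
    (krullTopology_mem_nhds_one_iff F K (H : Set (K ≃ₐ[F] K))).mp (hHo.mem_nhds H.one_mem)
  haveI := hEfin
  let A : FinSubextCat F K := ⟨E⟩
  have hz' : ∀ h ∈ A.L.fixingSubgroup, z * h = h * z := fun h hh => hz h (hEH hh)
  -- the automorphism of `D_A → D` attached to `z` is nontrivial, so some component acts nontrivially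
  obtain ⟨B, x, hx⟩ : ∃ (B : Over A) (x : S.Mon B.left),
      S.pull ((autForgetOfCentralizer hz').hom.app B) x ≠ x := by
    by_contra hcon
    push Not at hcon
    exact hne (eq_one_of_autForgetOfCentralizer_eq_refl hz'
      (hS A (autForgetOfCentralizer hz') hcon))
  -- the component at `B`, as an endomorphism of `B.left`
  let σB : B.left ⟶ B.left := (autForgetOfCentralizer hz').hom.app B
  change S.pull σB x ≠ x at hx
  -- transport to the normal closure `X` of the field of `B`
  let X : IntermediateField F K := normalClosure F B.left.L K
  haveI : FiniteDimensional F X := normalClosure.is_finiteDimensional F B.left.L K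
  haveI : Normal F X := normalClosure.normal F B.left.L K
  haveI : IsGalois F X := IsGalois.mk
  have hBX : B.left.L ≤ X := IntermediateField.le_normalClosure _
  let m : (⟨X⟩ : FinSubextCat F K) ⟶ B.left := ⟨IntermediateField.inclusion hBX⟩
  let g : K ≃ₐ[F] K := overLift A B
  have hsq : m ≫ σB = autMor X (overConj A z B) ≫ m :=
    hom_ext (AlgHom.ext fun a => Subtype.ext rfl)
  -- `g z g⁻¹` acts nontrivially on `Φ(X)`
  have hc : S.pull (autMor X (overConj A z B)) (S.pull m x) ≠ S.pull m x := by
    intro heq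
    apply hx
    apply hinj m
    rw [← S.pull_comp, hsq, S.pull_comp, heq]
  -- hence so does `z`
  refine ⟨⟨X⟩, inferInstance, autMor X z, fun a => rfl, ?_⟩
  by_contra hcon
  push Not at hcon
  apply hc
  have hfac : autMor X (overConj A z B) = autMor X g ≫ (autMor X z ≫ autMor X g⁻¹) := by
    rw [← autMor_mul, ← autMor_mul]
    rfl
  rw [hfac, S.pull_comp, S.pull_comp, hcon, ← S.pull_comp, ← autMor_mul, mul_inv_cancel, autMor_one,
    S.pull_id]

-- The assembled `S.IsDivSlim ↔ MovesSomeGalois S` (abc-iut-L1-t3's `PreFrobenioidData.IsDivSlim`,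
-- Def. 4.5 (iv)) is stated in the companion files of `GeometricFrobenioids` / `ArithmeticFrobenioids`.

end FinSubextCat

end Literature.AlgebraicGeometry.Frobenioids

end
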